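import Summits.ResolutionOfSingularities.ResolutionOfSingularities.Theses.RisoStrata

/-!
# Route RisoStrata — `RtdAffineLine` (item stmt-ResolutionOfSingularities-18551)

Sanity check of the route's inline riso-triviality-dimension encoding `Rtd` (Monreal,
arXiv:2606.12554, Cor. 4.3 "smooth points are riso-trivial", in the route's Hahn-series dress):
for `t` transcendental over a field `k` with `K = k(t)`, the subalgebra `B = k[t] ⊆ K` satisfies
`Rtd B m 1` at every maximal ideal `m ∋ t` (the origin of the affine line).

Witness: one generator `g 0 = t`, `W = ⊤ ≤ k¹` (`finrank = 1`) and the identity straightener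
`φ a 0 = a t`:
* two distinct arcs `a ≠ b : k[t] →ₐ[k] k⟦t^ℚ⟧` differ at `t` (`k[t] ≅ k[X]` since `t` is
  transcendental), so `ord (a t - b t) < ⊤ = ord 0`;
* `ord (a t) > 0` because `t ∈ m`;
* translation: for `w` of positive order the arc `b = ev_{a t + w}` exists (freeness of `k[X]`)
  and sends `m` to series of positive order, because every `f ∈ m` has zero constant term
  (`m` is proper and contains `t`), so `b f = (a t + w) · b (f / X)` with the second factor of
  nonnegative order.
Characteristic, algebraic closedness and `K = k(t)` are not used.
-/

-- single-problem summit: the doubled namespace component `ResolutionOfSingularities` is forced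
set_option linter.dupNamespace false

namespace Summit.ResolutionOfSingularities.ResolutionOfSingularities.Theorems

open Polynomial

section Helpers

variable {k : Type} [Field k]

/-- Evaluating a polynomial at a Hahn series of nonnegative order gives a Hahn series of
nonnegative order. -/
theorem rtdAffineLine_orderTop_aeval_nonneg {u : HahnSeries ℚ k} (hu : 0 ≤ u.orderTop)
    (f : k[X]) : 0 ≤ (aeval u f).orderTop := by
  induction f using Polynomial.induction_on' with
  | add p q hp hq =>
    rw [map_add]
    exact (le_min hp hq).trans HahnSeries.min_orderTop_le_orderTop_add
  | monomial n c =>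
    rw [aeval_monomial]
    refine (add_nonneg ?_ ?_).trans HahnSeries.orderTop_add_le_mul
    · -- (`import Mathlib` makes `algebraMap k k⟦t^ℚ⟧` factor through power series)
      have hC : algebraMap k (HahnSeries ℚ k) c = HahnSeries.C c := by
        first
        | rfl
        | (rw [HahnSeries.algebraMap_apply']; simp)
      rw [hC, HahnSeries.C_apply]
      exact HahnSeries.orderTop_single_le
    · exact (nsmul_nonneg hu n).trans HahnSeries.orderTop_nsmul_le_orderTop_pow

/-- Evaluating a polynomial without constant term at a Hahn series of positive order gives a
Hahn series of positive order. -/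
theorem rtdAffineLine_orderTop_aeval_pos {u : HahnSeries ℚ k} (hu : 0 < u.orderTop) {f : k[X]}
    (hf : f.coeff 0 = 0) : 0 < (aeval u f).orderTop := by
  have h := X_mul_divX_add f
  rw [hf, map_zero, add_zero] at h
  rw [← h, map_mul, aeval_X, HahnSeries.orderTop_mul]
  exact add_pos_of_pos_of_nonneg hu (rtdAffineLine_orderTop_aeval_nonneg hu.le _)

variable {K : Type} [Field K] [Algebra k K] {t : K}

/-- A polynomial whose value at a transcendental `t` lies in a proper ideal of `k[t]` containing
`t` has zero constant term. -/
theorem rtdAffineLine_coeff_zero_eq_zero (ht : Transcendental k t)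
    {m : Ideal ↥(Algebra.adjoin k ({t} : Set K))} (hm : m ≠ ⊤)
    (htm : (⟨t, Algebra.self_mem_adjoin_singleton k t⟩ : ↥(Algebra.adjoin k ({t} : Set K))) ∈ m)
    {f : k[X]} (hf : algEquivOfTranscendental k t ht f ∈ m) : f.coeff 0 = 0 := by
  by_contra hc
  apply hm
  refine Ideal.eq_top_of_isUnit_mem m (x := algebraMap k _ (f.coeff 0)) ?_
    ((Ne.isUnit hc).map _)
  have h := congrArg (algEquivOfTranscendental k t ht) (X_mul_divX_add f)
  rw [map_add, map_mul, algEquivOfTranscendental_apply_X, Polynomial.C_eq_algebraMap,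
    AlgEquiv.commutes] at h
  rw [eq_sub_of_add_eq' h]
  exact m.sub_mem hf (m.mul_mem_right _ htm)

/-- A `k`-algebra map out of `k[t]` (`t` transcendental) sending `t` to a Hahn series of positive
order sends every element of a proper ideal containing `t` to a Hahn series of positive order. -/
theorem rtdAffineLine_orderTop_pos_of_mem (ht : Transcendental k t)
    {m : Ideal ↥(Algebra.adjoin k ({t} : Set K))} (hm : m ≠ ⊤)
    (htm : (⟨t, Algebra.self_mem_adjoin_singleton k t⟩ : ↥(Algebra.adjoin k ({t} : Set K))) ∈ m)
    (ψ : ↥(Algebra.adjoin k ({t} : Set K)) →ₐ[k] HahnSeries ℚ k)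
    (hψ : 0 < (ψ ⟨t, Algebra.self_mem_adjoin_singleton k t⟩).orderTop)
    {b : ↥(Algebra.adjoin k ({t} : Set K))} (hb : b ∈ m) : 0 < (ψ b).orderTop := by
  obtain ⟨f, rfl⟩ := (algEquivOfTranscendental k t ht).surjective b
  have key : ψ (algEquivOfTranscendental k t ht f) =
      aeval (ψ ⟨t, Algebra.self_mem_adjoin_singleton k t⟩) f := by
    rw [← algEquivOfTranscendental_apply_X k t ht]
    change _ = aeval ((ψ.comp (algEquivOfTranscendental k t ht : k[X] →ₐ[k] _)) X) f
    rw [aeval_algHom_apply, aeval_X_left_apply]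
    rfl
  rw [key]
  exact rtdAffineLine_orderTop_aeval_pos hψ (rtdAffineLine_coeff_zero_eq_zero ht hm htm hb)

/-- Two `k`-algebra maps out of `k[t]` (`t` transcendental) that agree at `t` are equal. -/
theorem rtdAffineLine_algHom_eq (ht : Transcendental k t) {A : Type} [Semiring A] [Algebra k A]
    {α β : ↥(Algebra.adjoin k ({t} : Set K)) →ₐ[k] A}
    (h : α ⟨t, Algebra.self_mem_adjoin_singleton k t⟩ = β ⟨t, Algebra.self_mem_adjoin_singleton k t⟩) :
    α = β := by
  have hX : (α.comp (algEquivOfTranscendental k t ht : k[X] →ₐ[k] _)) X =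
      (β.comp (algEquivOfTranscendental k t ht : k[X] →ₐ[k] _)) X := by
    change α (algEquivOfTranscendental k t ht X) = β (algEquivOfTranscendental k t ht X)
    rwa [algEquivOfTranscendental_apply_X]
  have hcomp := Polynomial.algHom_ext hX
  ext x
  obtain ⟨f, rfl⟩ := (algEquivOfTranscendental k t ht).surjective x
  exact DFunLike.congr_fun hcomp f

end Helpers

open Summit.ResolutionOfSingularities.ResolutionOfSingularities.Theses.RisoStrata in
/-- **`RtdAffineLine`** (item stmt-ResolutionOfSingularities-18551 of route RisoStrata): the affine
line `k[t] ⊆ k(t)` has riso-triviality dimension `≥ 1` at the origin in the route's encoding —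
witness `n = 1`, `g 0 = t`, `W = ⊤`, identity straightener `φ a 0 = a t`. -/
theorem rtdAffineLine_proof : RtdAffineLine := by
  intro p _ k _ _ _ K _ _ t ht _
  dsimp only
  intro m hm htm
  have hm' : m ≠ ⊤ := hm.ne_top
  refine ⟨1, fun _ => ⟨t, Algebra.self_mem_adjoin_singleton k t⟩, fun _ => htm, ?_, ⊤, ?_,
    fun a _ => a.1 ⟨t, Algebra.self_mem_adjoin_singleton k t⟩, ?_, fun a _ => a.2 _ htm, ?_⟩
  · -- the single generator `t` generates `k[t]`
    simp
  · -- `finrank k k¹ = 1`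
    rw [finrank_top, Module.finrank_fin_fun]
  · -- rv-separation: distinct arcs differ at `t`, and the straightened difference vanishes
    intro a b hab
    refine ⟨0, fun i => ?_⟩
    rw [sub_self, HahnSeries.orderTop_zero, WithTop.lt_top_iff_ne_top, Ne,
      HahnSeries.orderTop_eq_top, sub_eq_zero]
    exact fun h => hab (Subtype.ext (rtdAffineLine_algHom_eq ht h))
  · -- translation by any `w` of positive order: the arc `t ↦ a t + w 0`
    intro a w hw _
    have hu : 0 < (a.1 ⟨t, Algebra.self_mem_adjoin_singleton k t⟩ + w 0).orderTop :=
      (lt_min (a.2 _ htm) (hw 0)).trans_le HahnSeries.min_orderTop_le_orderTop_add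
    have hψt : ((aeval (a.1 ⟨t, Algebra.self_mem_adjoin_singleton k t⟩ + w 0)).comp
        (algEquivOfTranscendental k t ht).symm.toAlgHom)
          ⟨t, Algebra.self_mem_adjoin_singleton k t⟩ =
        a.1 ⟨t, Algebra.self_mem_adjoin_singleton k t⟩ + w 0 := by
      change aeval _ ((algEquivOfTranscendental k t ht).symm _) = _
      rw [algEquivOfTranscendental_symm_gen, aeval_X]
    refine ⟨⟨(aeval (a.1 ⟨t, Algebra.self_mem_adjoin_singleton k t⟩ + w 0)).comp
        (algEquivOfTranscendental k t ht).symm.toAlgHom, fun b hb =>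
          rtdAffineLine_orderTop_pos_of_mem ht hm' htm _ (hψt.symm ▸ hu) hb⟩, ?_⟩
    funext i
    rw [Pi.add_apply, Subsingleton.elim i 0]
    exact hψt

end Summit.ResolutionOfSingularities.ResolutionOfSingularities.Theorems
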